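import Summits.Ventures.PercRepro.ProfileGapMonoColoopBandSucc

/-!
# PercRepro — THE PARALLEL CASE OF THE THRESHOLD FAMILY (p5, gen 23; `proofs/P5-GM1.md` §21(m); announced
INBOX 11603)

For `z ∥ z'` the sets of `N` in which the class of `z` is partial carry the ranks of `N ∖ z ／ z'` raised by one on both
sides (p10's `sum_parallel_transfer` / `sum_parallel_contract`, for any statistic `φ(ρ(X), ρ(E ∖ X))`), and they are
exactly what `N` has twice as often as `N ∖ z`; so `Φ_t(N) − Φ_t(N ∖ z) = 2 · [Φ^{(q−1)}_{t−1}(N'') + (#T' − #L')]`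
with `N'' := N ∖ z ／ z'`, and `(I_{t−1})` at co-rank `q − 1` for `N''` gives `DelMonoT N z q t` (`2 ≤ q`,
`q − 1 ≤ t`) — the same shape as the generic case.

* `thresholdSum_eq_powerset`, **`delMonoT_of_parallel`**.
-/

open scoped Matroid

namespace PercRepro.Cogirth

open Finset ThmH Skew Shadow Profile

variable {α : Type} [DecidableEq α] {M : Matroid α} [M.Finite]

section ThresholdParallel

variable {N : Matroid α} [N.Finite] {q t : ℕ}

/-- The threshold demand as a statistic of `(ρ(X), ρ(E ∖ X))` over the power set. -/
theorem thresholdSum_eq_powerset (K : Matroid α) [K.Finite] (q t : ℕ) :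
    thresholdSum K q t = ∑ X ∈ (gr K).powerset,
      (fun a b => if a = q - 1 then (if t + 1 ≤ b then b else 0) else 0) (rk K X) (rk K (gr K \ X)) := by
  have hR : Rq K (q - 1) = (gr K).powerset.filter (fun X => rk K X = q - 1) := by
    ext X
    rw [mem_Rq, mem_filter, mem_powerset]
    constructor
    · rintro ⟨h1, h2⟩
      exact ⟨h1, rk_eq_of_eRk_eq_cq h2⟩
    · rintro ⟨h1, h2⟩
      exact ⟨h1, eRk_eq_of_rk_eq_cq h2⟩
  unfold thresholdSum
  rw [hR, sum_filter]

/-- **Deletion monotonicity of the threshold gap at a parallel element**: for `z ∥ z'` (`2 ≤ q`, `q − 1 ≤ t`),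
`DelMonoT N z q t` follows from `(I_{t−1})` at co-rank `q − 1` for `N ∖ z ／ z'`. -/
theorem delMonoT_of_parallel {z z' : α} (hz : z ∈ gr N) (hz' : z' ∈ gr N) (hzz' : z ≠ z')
    (h0 : rk N {z} = 1) (h1 : rk N {z'} = 1) (hpar : rk N {z, z'} = 1) (hq : 2 ≤ q) (hqt : q - 1 ≤ t)
    (hdel : ThresholdIneq ((N ＼ ({z} : Set α)) ／ ({z'} : Set α)) (q - 1) (t - 1)) : DelMonoT N z q t := by
  unfold DelMonoT
  unfold ThresholdIneq at hdel
  have hz'E'' : z' ∈ (gr N).erase z := mem_erase.2 ⟨Ne.symm hzz', hz'⟩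
  have hz'I : (N ＼ ({z} : Set α)).Indep {z'} := by
    have h := indep_of_rk_eq_card (M := N ＼ ({z} : Set α)) (X := {z'})
      (by rw [card_singleton, rk_delete (singleton_subset_iff.2 hz'E'')]; exact h1)
    rwa [coe_singleton] at h
  -- the two statistics of `N` through the transfer and the contraction
  have hD := sum_parallel_transfer hz hz' hzz' h0 h1 hpar
    (fun a b => if a = q - 1 then (if t + 1 ≤ b then b else 0) else 0)
  have hW := sum_parallel_transfer hz hz' hzz' h0 h1 hpar
    (fun a b => if a = q then (if t ≤ b then 1 else 0) else 0)
  rw [sum_parallel_contract hz'I (fun a b => if a = q - 1 then (if t + 1 ≤ b then b else 0) else 0)] at hD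
  rw [sum_parallel_contract hz'I (fun a b => if a = q then (if t ≤ b then 1 else 0) else 0)] at hW
  rw [thresholdSum_eq_powerset N q t, thresholdSum_eq_powerset (N ＼ ({z} : Set α)) q t,
    card_levelSetCoQ_eq_powerset N t q, card_levelSetCoQ_eq_powerset (N ＼ ({z} : Set α)) t q, hD, hW]
  rw [thresholdSum_eq_powerset, card_levelSetCoQ_eq_powerset] at hdel
  beta_reduce at hdel
  set K := (N ＼ ({z} : Set α)) ／ ({z'} : Set α) with hK
  have e1 : q - 1 - 1 = q - 2 := by omega
  have e2 : t - 1 + 1 = t := by omega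
  rw [e1, e2] at hdel
  -- the through-class demand is the threshold demand of `K` one co-rank down plus the count `L''`
  have hSL : ∑ A' ∈ (gr K).powerset,
      (if rk K A' + 1 = q - 1 then (if t + 1 ≤ rk K (gr K \ A') + 1 then rk K (gr K \ A') + 1 else 0) else 0) =
      ∑ A' ∈ (gr K).powerset, (if rk K A' = q - 2 then (if t ≤ rk K (gr K \ A') then rk K (gr K \ A') else 0) else 0) +
      ∑ A' ∈ (gr K).powerset, (if rk K A' = q - 2 then (if t ≤ rk K (gr K \ A') then 1 else 0) else 0) := by
    rw [← sum_add_distrib]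
    apply sum_congr rfl
    intro A' _
    split_ifs <;> omega
  have hSW : ∑ A' ∈ (gr K).powerset,
      (if rk K A' + 1 = q then (if t ≤ rk K (gr K \ A') + 1 then 1 else 0) else 0) =
      ∑ A' ∈ (gr K).powerset, (if rk K A' = q - 1 then (if t - 1 ≤ rk K (gr K \ A') then 1 else 0) else 0) := by
    apply sum_congr rfl
    intro A' _
    split_ifs <;> omega
  -- `t · L'' ≤ thr''`
  have hLt : t * ∑ A' ∈ (gr K).powerset, (if rk K A' = q - 2 then (if t ≤ rk K (gr K \ A') then 1 else 0) else 0) ≤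
      ∑ A' ∈ (gr K).powerset, (if rk K A' = q - 2 then (if t ≤ rk K (gr K \ A') then rk K (gr K \ A') else 0) else 0) := by
    rw [mul_sum]
    apply sum_le_sum
    intro A' _
    split_ifs <;> omega
  rw [hSL, hSW]
  generalize hT : (∑ A' ∈ (gr K).powerset,
      (if rk K A' = q - 2 then (if t ≤ rk K (gr K \ A') then rk K (gr K \ A') else 0) else 0)) = TH at hdel hLt ⊢
  generalize hL : (∑ A' ∈ (gr K).powerset,
      (if rk K A' = q - 2 then (if t ≤ rk K (gr K \ A') then 1 else 0) else 0)) = LL at hLt ⊢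
  generalize hWW : (∑ A' ∈ (gr K).powerset,
      (if rk K A' = q - 1 then (if t - 1 ≤ rk K (gr K \ A') then 1 else 0) else 0)) = WW at hdel ⊢
  generalize (∑ X ∈ (gr (N ＼ ({z} : Set α))).powerset,
      (if rk (N ＼ ({z} : Set α)) X = q - 1 then
        (if t + 1 ≤ rk (N ＼ ({z} : Set α)) (gr (N ＼ ({z} : Set α)) \ X) then
          rk (N ＼ ({z} : Set α)) (gr (N ＼ ({z} : Set α)) \ X) else 0) else 0)) = DN' at ⊢
  generalize (∑ X ∈ (gr (N ＼ ({z} : Set α))).powerset,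
      (if rk (N ＼ ({z} : Set α)) X = q then
        (if t ≤ rk (N ＼ ({z} : Set α)) (gr (N ＼ ({z} : Set α)) \ X) then 1 else 0) else 0)) = WN' at ⊢
  -- `LL ≤ WW` from `t · LL ≤ TH ≤ (q−1) · WW ≤ t · WW`
  have hLW : LL ≤ WW := by
    have h3 : t * LL ≤ t * WW := by
      calc t * LL ≤ TH := hLt
        _ ≤ (q - 1) * WW := hdel
        _ ≤ t * WW := Nat.mul_le_mul_right _ hqt
    exact Nat.le_of_mul_le_mul_left h3 (by omega)
  have hq1 : (q - 1) * WW + WW = q * WW := by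
    have hq' : q - 1 + 1 = q := Nat.sub_add_cancel (by omega : 1 ≤ q)
    calc (q - 1) * WW + WW = (q - 1 + 1) * WW := by ring
      _ = q * WW := by rw [hq']
  have hA : TH + LL ≤ q * WW := by omega
  have e3 : q * (WN' + 2 * WW) = q * WN' + 2 * (q * WW) := by ring
  rw [e3]
  omega

end ThresholdParallel

end PercRepro.Cogirth
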